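import Literature.MathematicalPhysics.StatisticalMechanics.IsothermalEquationsOfState
import HarnessLib

/-!
# A bulk-modulus floor for the third-order Birch–Murnaghan law below `B₀' = 4`

`IsothermalEquationsOfState` proves, for the third-order Birch–Murnaghan law with `B₀' ≥ 4`, the
growing floor `B₀ + (7/3) P(V) ≤ K(V)` (`birchMurnaghan3_le_bulkModulus`) and, for ANY law whose
bulk modulus `K(v) = -v P'(v)` stays `≥ B₀` on `[V, V₀]`, the comparison principle
`B₀ ln(V₀/V) ≤ P(V)` (`mul_log_div_le_of_bulkModulus_ge`)
[cite: Poirier1991, §4.4 eq. (4.46) (elementary consequence of `K = -V dP/dV`)].  Printed fits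
with `B₀' < 4` (e.g. `B₀' = 2.51` for tetragonal SrFe₂As₂ in a He medium, `3.5` for bcc Li,
`3` for CaH₆) were not covered.  From the closed form
`K(V) = B₀ q⁵ [1 + 7f + (3/2)(B₀' - 4) f (2 + 9f)]`, `q = (V₀/V)^{1/3}`, `f = (q² - 1)/2`
[cite: Poirier1991, §4.3.2 eqs. (4.35)–(4.37)] one reads off
`[…] - 1 = (u/8)·(4(3B₀' - 5) - 27(4 - B₀') u)` with `u = q² - 1 ≥ 0`, hence the FLAT FLOOR
`K(V) ≥ B₀` holds on the COMPRESSION WINDOW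

  `27 (4 - B₀') (q² - 1) ≤ 4 (3 B₀' - 5)`,

i.e. for every volume when `B₀' ≥ 4`, and down to `V/V₀ = (1 + 4(3B₀'-5)/(27(4-B₀')))^{-3/2}` when
`5/3 < B₀' < 4` (`B₀' = 2.51`: `V/V₀ ≥ 0.715`; `B₀' = 3`: `≥ 0.50`; `B₀' = 3.5`: `≥ 0.24`).  This
file PROVES (no named facts):

* `birchMurnaghan3Bracket_ge_one_of_window` — the shape inequality above (pure algebra);
* `cubeRootRatio_antitoneOn'` / `birchMurnaghan3Window_mono` — the window is inherited by every
  `W ∈ [V, V₀]`;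
* `birchMurnaghan3_bulkModulus_ge_of_window` — `B₀ ≤ K(V) = -V P'(V)` on the window (`B₀ ≥ 0`);
* `birchMurnaghan3_mul_log_div_le_of_window` — `B₀ ln(V₀/V) ≤ P(V)` on the window, and its
  compressibility form `birchMurnaghan3_log_div_le_div_of_window` (`ln(V₀/V) ≤ P(V)/B₀`): the
  EOS-free reading rule «the linear-compressibility estimate never under-states the compression»
  now licensed for the printed `B₀' < 4` Birch–Murnaghan fits inside their window.
-/

namespace Literature.MathematicalPhysics.StatisticalMechanics

noncomputable section

open Real Set

/-! ## The shape inequality -/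

/-- THE BRACKET OF THE BIRCH–MURNAGHAN BULK MODULUS IS AT LEAST ONE ON THE WINDOW: for `q ≥ 1` and
`27(4 - B₀')(q² - 1) ≤ 4(3B₀' - 5)`,
`1 ≤ 1 + 7f + (3/2)(B₀' - 4) f (2 + 9f)` with `f = (q² - 1)/2`
(the difference is `(u/8)(4(3B₀'-5) - 27(4-B₀')u)`, `u = q² - 1 ≥ 0`).
[cite: Poirier1991, §4.3.2 eqs. (4.35)–(4.37) (elementary consequence)] -/
theorem birchMurnaghan3Bracket_ge_one_of_window {B₀' q : ℝ} (hq : 1 ≤ q)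
    (hwin : 27 * (4 - B₀') * (q ^ 2 - 1) ≤ 4 * (3 * B₀' - 5)) :
    1 ≤ 1 + 7 * ((q ^ 2 - 1) / 2) +
      3 / 2 * (B₀' - 4) * ((q ^ 2 - 1) / 2) * (2 + 9 * ((q ^ 2 - 1) / 2)) := by
  have hu : 0 ≤ q ^ 2 - 1 := by nlinarith
  have hkey : 0 ≤ (q ^ 2 - 1) * (4 * (3 * B₀' - 5) - 27 * (4 - B₀') * (q ^ 2 - 1)) :=
    mul_nonneg hu (by linarith)
  nlinarith [hkey]

/-! ## The compression variable is antitone, so the window is inherited on `[V, V₀]` -/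

/-- `q = (V₀/V)^{1/3} ≥ 1` for `0 < V ≤ V₀`. [cite: Poirier1991, §4.3.2 (elementary)] -/
theorem one_le_cubeRootRatio' {V₀ V : ℝ} (hV : 0 < V) (hle : V ≤ V₀) :
    1 ≤ cubeRootRatio V₀ V :=
  Real.one_le_rpow ((one_le_div hV).mpr hle) (by norm_num)

/-- `q = (V₀/V)^{1/3}` is antitone in `V` on `V > 0` (`V₀ ≥ 0`).
[cite: Poirier1991, §4.3.2 (elementary)] -/
theorem cubeRootRatio_antitoneOn' {V₀ : ℝ} (hV₀ : 0 ≤ V₀) :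
    AntitoneOn (fun V : ℝ => cubeRootRatio V₀ V) (Ioi (0 : ℝ)) := by
  intro V hV W _ hVW
  have hV0 : (0 : ℝ) < V := hV
  show cubeRootRatio V₀ W ≤ cubeRootRatio V₀ V
  unfold cubeRootRatio
  refine Real.rpow_le_rpow (div_nonneg hV₀ (le_of_lt (lt_of_lt_of_le hV0 hVW))) ?_ (by norm_num)
  exact div_le_div_of_nonneg_left hV₀ hV0 hVW

/-- THE WINDOW IS INHERITED: if `27(4 - B₀')(q(V)² - 1) ≤ 4(3B₀' - 5)` holds at `V`, then it
holds at every `W ∈ [V, V₀]` (`0 < V ≤ W ≤ V₀`), because `q` decreases towards `1` as `W → V₀`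
(for `B₀' > 4` the left side is nonpositive and the right side positive).
[cite: Poirier1991, §4.3.2 (elementary consequence)] -/
theorem birchMurnaghan3Window_mono {V₀ B₀' V W : ℝ} (hV : 0 < V) (hVW : V ≤ W) (hWV₀ : W ≤ V₀)
    (hwin : 27 * (4 - B₀') * (cubeRootRatio V₀ V ^ 2 - 1) ≤ 4 * (3 * B₀' - 5)) :
    27 * (4 - B₀') * (cubeRootRatio V₀ W ^ 2 - 1) ≤ 4 * (3 * B₀' - 5) := by
  have hW : 0 < W := lt_of_lt_of_le hV hVW
  have hV₀ : 0 ≤ V₀ := le_of_lt (lt_of_lt_of_le hW hWV₀)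
  have hqW1 : 1 ≤ cubeRootRatio V₀ W := one_le_cubeRootRatio' hW hWV₀
  have hqWV : cubeRootRatio V₀ W ≤ cubeRootRatio V₀ V :=
    cubeRootRatio_antitoneOn' hV₀ (show (0:ℝ) < V from hV) (show (0:ℝ) < W from hW) hVW
  have hsq : cubeRootRatio V₀ W ^ 2 - 1 ≤ cubeRootRatio V₀ V ^ 2 - 1 := by
    nlinarith [hqW1, hqWV]
  have huW : 0 ≤ cubeRootRatio V₀ W ^ 2 - 1 := by nlinarith [hqW1]
  rcases le_or_gt B₀' 4 with hle | hlt
  · -- `4 - B₀' ≥ 0`: the left side is monotone in `q² - 1`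
    have h27 : 0 ≤ 27 * (4 - B₀') := by linarith
    calc 27 * (4 - B₀') * (cubeRootRatio V₀ W ^ 2 - 1)
        ≤ 27 * (4 - B₀') * (cubeRootRatio V₀ V ^ 2 - 1) :=
          mul_le_mul_of_nonneg_left hsq h27
      _ ≤ 4 * (3 * B₀' - 5) := hwin
  · -- `B₀' > 4`: the left side is nonpositive, the right side positive
    have hneg : 27 * (4 - B₀') * (cubeRootRatio V₀ W ^ 2 - 1) ≤ 0 :=
      mul_nonpos_of_nonpos_of_nonneg (by linarith) huW
    linarith

/-! ## The modulus floor and the logarithmic reading rule -/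

/-- FLAT MODULUS FLOOR BELOW `B₀' = 4`: for the third-order Birch–Murnaghan law with `V₀ > 0`,
`B₀ ≥ 0`, at a compression `0 < V ≤ V₀` inside the window `27(4 - B₀')(q² - 1) ≤ 4(3B₀' - 5)`
(`q = (V₀/V)^{1/3}`), the pressure is differentiable with `B₀ ≤ K(V) = -V P'(V)`.
[cite: Poirier1991, §4.3.2 eqs. (4.35)–(4.37) (elementary consequence)] -/
theorem birchMurnaghan3_bulkModulus_ge_of_window {V₀ B₀ B₀' V : ℝ} (hV₀ : 0 < V₀) (hB₀ : 0 ≤ B₀)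
    (hV : 0 < V) (hVV₀ : V ≤ V₀)
    (hwin : 27 * (4 - B₀') * (cubeRootRatio V₀ V ^ 2 - 1) ≤ 4 * (3 * B₀' - 5)) :
    ∃ P' : ℝ, HasDerivAt (birchMurnaghan3Pressure V₀ B₀ B₀') P' V ∧ B₀ ≤ -V * P' := by
  obtain ⟨P', hP', hK⟩ := birchMurnaghan3_bulkModulus hV₀ hV B₀ B₀'
  refine ⟨P', hP', ?_⟩
  have hq1 : 1 ≤ cubeRootRatio V₀ V := one_le_cubeRootRatio' hV hVV₀
  have hq5 : 1 ≤ cubeRootRatio V₀ V ^ 5 := one_le_pow₀ hq1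
  -- rewrite the Eulerian strain through `q`
  have hf : eulerianStrain V₀ V = (cubeRootRatio V₀ V ^ 2 - 1) / 2 := by
    unfold eulerianStrain cubeRootRatio
    have hr : 0 ≤ V₀ / V := div_nonneg hV₀.le hV.le
    rw [← Real.rpow_natCast ((V₀ / V) ^ ((1:ℝ)/3)) 2, ← Real.rpow_mul hr]
    norm_num
  have hbr := birchMurnaghan3Bracket_ge_one_of_window hq1 hwin
  rw [hK, hf]
  have hprod : (1 : ℝ) * 1 ≤ cubeRootRatio V₀ V ^ 5 *
      (1 + 7 * ((cubeRootRatio V₀ V ^ 2 - 1) / 2) +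
        3 / 2 * (B₀' - 4) * ((cubeRootRatio V₀ V ^ 2 - 1) / 2) *
          (2 + 9 * ((cubeRootRatio V₀ V ^ 2 - 1) / 2))) :=
    mul_le_mul hq5 hbr zero_le_one (le_trans zero_le_one hq5)
  calc B₀ = B₀ * (1 * 1) := by ring
    _ ≤ B₀ * (cubeRootRatio V₀ V ^ 5 *
        (1 + 7 * ((cubeRootRatio V₀ V ^ 2 - 1) / 2) +
          3 / 2 * (B₀' - 4) * ((cubeRootRatio V₀ V ^ 2 - 1) / 2) *
            (2 + 9 * ((cubeRootRatio V₀ V ^ 2 - 1) / 2)))) :=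
        mul_le_mul_of_nonneg_left hprod hB₀
    _ = _ := by ring

/-- THE LOGARITHMIC READING RULE FOR `B₀' < 4` FITS: for the third-order Birch–Murnaghan law with
`V₀ > 0`, `B₀ ≥ 0`, at every compression `0 < V ≤ V₀` inside the window
`27(4 - B₀')(q² - 1) ≤ 4(3B₀' - 5)` one has `B₀ ln(V₀/V) ≤ P(V)` — the comparison principle
`mul_log_div_le_of_bulkModulus_ge` fed with the floor `K ≥ B₀` inherited on `[V, V₀]`.
[cite: Poirier1991, §4.4 eq. (4.46) and §4.3.2 eqs. (4.35)–(4.37) (elementary consequence)] -/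
theorem birchMurnaghan3_mul_log_div_le_of_window {V₀ B₀ B₀' V : ℝ} (hV₀ : 0 < V₀) (hB₀ : 0 ≤ B₀)
    (hV : 0 < V) (hVV₀ : V ≤ V₀)
    (hwin : 27 * (4 - B₀') * (cubeRootRatio V₀ V ^ 2 - 1) ≤ 4 * (3 * B₀' - 5)) :
    B₀ * Real.log (V₀ / V) ≤ birchMurnaghan3Pressure V₀ B₀ B₀' V := by
  refine mul_log_div_le_of_bulkModulus_ge (P' := fun v => deriv (birchMurnaghan3Pressure V₀ B₀ B₀') v)
    hV hVV₀ (birchMurnaghan3Pressure_self hV₀ B₀ B₀') ?_ ?_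
  · intro v hv
    have hv0 : 0 < v := lt_of_lt_of_le hV hv.1
    obtain ⟨P', hP', _⟩ := birchMurnaghan3_bulkModulus hV₀ hv0 B₀ B₀'
    exact hP'.differentiableAt.hasDerivAt
  · intro v hv
    have hv0 : 0 < v := lt_of_lt_of_le hV hv.1
    have hwv := birchMurnaghan3Window_mono hV hv.1 hv.2 hwin
    obtain ⟨P', hP', hfloor⟩ := birchMurnaghan3_bulkModulus_ge_of_window hV₀ hB₀ hv0 hv.2 hwv
    rwa [hP'.deriv]

/-- Compressibility form of the rule: `ln(V₀/V) ≤ P(V)/B₀` on the window (`B₀ > 0`).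
[cite: Poirier1991, §4.4 eq. (4.46) (elementary consequence)] -/
theorem birchMurnaghan3_log_div_le_div_of_window {V₀ B₀ B₀' V : ℝ} (hV₀ : 0 < V₀) (hB₀ : 0 < B₀)
    (hV : 0 < V) (hVV₀ : V ≤ V₀)
    (hwin : 27 * (4 - B₀') * (cubeRootRatio V₀ V ^ 2 - 1) ≤ 4 * (3 * B₀' - 5)) :
    Real.log (V₀ / V) ≤ birchMurnaghan3Pressure V₀ B₀ B₀' V / B₀ := by
  rw [le_div_iff₀ hB₀, mul_comm]
  exact birchMurnaghan3_mul_log_div_le_of_window hV₀ hB₀.le hV hVV₀ hwin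

/-- WORKED WINDOW (the SrFe₂As₂ fit, `B₀' = 2.51`): the window condition at `q² = 5/4`
(`V/V₀ = (4/5)^{3/2} ≈ 0.716`) reads `27 · 1.49 · (1/4) = 10.0575 ≤ 10.12 = 4 · 2.53`.
[cite: Poirier1991, §4.3.2 (numerical instance)] -/
example : 27 * (4 - (2.51 : ℝ)) * (5 / 4 - 1) ≤ 4 * (3 * 2.51 - 5) := by norm_num

end

end Literature.MathematicalPhysics.StatisticalMechanics
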